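import Mathlib

/-!
# Multi-event mass: the total mass of a finite family of events is at most `2|X|` plus collisions

Crux `Summit.MatrixMultiplication.MatrixMultiplication.Theses.SnSubsetDichotomy.PolynomialSlack`
(item `stmt-MatrixMultiplication-8306`), line transport-split-hull (lead c9), programme B (the excess
case at level one, beyond exponent `5/8`), stub B1 "MultiEventMass".

For a finset `X` and a finite family of decidable events `E l` on it,

  `2 · Σ_l #{x ∈ X | E l x} ≤ 2·#X + Σ_l Σ_{l' ≠ l} #{x ∈ X | E l x ∧ E l' x}`   (`two_mul_sum_card_filter_le`).

This is the abstract core of the sharp heavy-mass bound (heavy cells of a quotient profile carry total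
mass `≤ 1 + (pair collisions)`), in the MULTI-EVENT form with explicit pairwise intersection counts:
`X` is a quotient set and `E l` = "realises the `l`-th heavy cell / cylinder".

Proof: with `c(x) = #{l | E l x}`, both sides are sums over `x ∈ X` (exchange of summations):
`Σ_l #{x ∈ X | E l x} = Σ_{x ∈ X} c(x)` and `Σ_l Σ_{l' ≠ l} #{x ∈ X | E l x ∧ E l' x} = Σ_{x ∈ X} c(x)(c(x)-1)`
(ordered pairs of distinct elements of `{l | E l x}`), and pointwise `2c ≤ 2 + c(c-1)` for every
natural number `c`.
-/

namespace Summit.MatrixMultiplication.MatrixMultiplication.Theorems.PolynomialSlack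

set_option linter.dupNamespace false

open scoped BigOperators

/-- Pointwise inequality `2c ≤ 2 + c(c-1)` for a natural number `c` (truncated subtraction;
check `c = 0, 1` directly, and `2(k+2) ≤ 2 + (k+2)(k+1)` for `c = k + 2`). [folklore] -/
theorem two_mul_le_two_add_mul_sub_one (c : ℕ) : 2 * c ≤ 2 + c * (c - 1) := by
  rcases c with _ | _ | c
  · norm_num
  · norm_num
  · rw [Nat.add_sub_cancel]
    nlinarith [Nat.zero_le c]

/-- Exchange of summations: the total size of the events equals the sum over `x ∈ X` of the number
`#{l | E l x}` of events containing `x`. [folklore] -/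
theorem sum_card_filter_eq_sum_card_filter_univ {α ι : Type*} [Fintype ι] (X : Finset α)
    (E : ι → α → Prop) [∀ l, DecidablePred (E l)] :
    ∑ l, (X.filter (E l)).card = ∑ x ∈ X, (Finset.univ.filter fun l => E l x).card := by
  simp only [Finset.card_filter]
  exact Finset.sum_comm

/-- Exchange of summations for ordered pairs of distinct events: the total size of the pairwise
intersections `#{x ∈ X | E l x ∧ E l' x}` over `l' ≠ l` equals the sum over `x ∈ X` of `c(x)(c(x)-1)`,
`c(x) = #{l | E l x}` (the number of ordered pairs of distinct elements of `{l | E l x}`). [folklore] -/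
theorem sum_sum_erase_card_filter_and_eq {α ι : Type*} [Fintype ι] [DecidableEq ι] (X : Finset α)
    (E : ι → α → Prop) [∀ l, DecidablePred (E l)] :
    ∑ l, ∑ l' ∈ Finset.univ.erase l, (X.filter fun x => E l x ∧ E l' x).card =
      ∑ x ∈ X, (Finset.univ.filter fun l => E l x).card *
        ((Finset.univ.filter fun l => E l x).card - 1) := by
  have step : ∀ l, ∑ l' ∈ Finset.univ.erase l, (X.filter fun x => E l x ∧ E l' x).card =
      ∑ x ∈ X, ∑ l' ∈ Finset.univ.erase l, if E l x ∧ E l' x then 1 else 0 := by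
    intro l
    simp only [Finset.card_filter]
    exact Finset.sum_comm
  simp only [step]
  rw [Finset.sum_comm]
  refine Finset.sum_congr rfl fun x _ => ?_
  have inner : ∀ l, (∑ l' ∈ Finset.univ.erase l, if E l x ∧ E l' x then 1 else 0) =
      if E l x then (Finset.univ.filter fun l => E l x).card - 1 else 0 := by
    intro l
    by_cases h : E l x
    · simp only [h, true_and, if_true]
      rw [← Finset.card_filter, Finset.filter_erase, Finset.card_erase_of_mem]
      exact Finset.mem_filter.2 ⟨Finset.mem_univ _, h⟩
    · simp [h]
  simp only [inner]
  rw [← Finset.sum_filter, Finset.sum_const, smul_eq_mul]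

/-- **Multi-event mass bound.** For a finset `X` and a finite family of decidable events `E l`,
`2 · Σ_l #{x ∈ X | E l x} ≤ 2·#X + Σ_l Σ_{l' ≠ l} #{x ∈ X | E l x ∧ E l' x}`: the total mass of the
events is at most twice the ground set plus the ordered pairwise collisions. Proof: both sides are
sums over `x ∈ X` (`sum_card_filter_eq_sum_card_filter_univ`, `sum_sum_erase_card_filter_and_eq`)
and pointwise `2c ≤ 2 + c(c-1)` (`two_mul_le_two_add_mul_sub_one`). [folklore] -/
theorem two_mul_sum_card_filter_le {α ι : Type*} [Fintype ι] [DecidableEq ι] (X : Finset α) (E : ι → α → Prop) [∀ l, DecidablePred (E l)] : 2 * ∑ l, (X.filter (E l)).card ≤ 2 * X.card + ∑ l, ∑ l' ∈ Finset.univ.erase l, (X.filter fun x => E l x ∧ E l' x).card := by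
  rw [sum_card_filter_eq_sum_card_filter_univ, sum_sum_erase_card_filter_and_eq, Finset.mul_sum,
    Finset.card_eq_sum_ones X, Finset.mul_sum, ← Finset.sum_add_distrib]
  refine Finset.sum_le_sum fun x _ => ?_
  rw [mul_one]
  exact two_mul_le_two_add_mul_sub_one _

end Summit.MatrixMultiplication.MatrixMultiplication.Theorems.PolynomialSlack
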